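import Summits.ResolutionOfSingularities.ResolutionOfSingularities.Theorems.FrobeniusLadderFInjectiveMacaulayficationLocFixAtNonClosedLowDim
import Literature.AlgebraicGeometry.Resolution.MonomialOrderReductionUnit
import HarnessLib

/-!
# (T1″) of the (A′) route: the FULL LocFix datum at every non-closed bad point `η` with `2 ≤ dim 𝒪_η ≤ 3` — ALL primes of ALL
# affine blow-up charts `𝒪_η[(c′)/c′ⱼ]` are FULL — from Lipman 1978 (dim 2) and Cossart–Piltant 2019 (dim 3) by the generic-fibre
# transfer and the general-prime chart–point dictionary (Stacks 0804)
# (crux `FInjectiveMacaulayfication` stmt-ResolutionOfSingularities-15315, chain w45a; res-L1-w45a-plan-1 R16.12 (2)/R16.13 (1b); target =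
# `FCUnguardedAprime.LocFixFullAtNonClosed` of FC2Dim4Sig v0.7 (res-L1-w45a-stub-3), whose binders are restated here unfolded; seat
# res-L1-w45a-stub-1 g6)

[OURS · L1 W4.5a] Support file (`--supports stmt-ResolutionOfSingularities-15315 --as helper`); NOT a statement of any manuscript;
AI-written (AI review is weaker than expert review). No definitions; named facts only as hypotheses BY NAME (Lipman 1978,
Cossart–Piltant 2019 ×2, Stacks 081R, Datta–Murayama 2024 Thm. B, `CMLocusOpen`).

THE POINT. (T1′) (`LocFixAtNonClosedLowDim.locFixAprime_atNonClosed_lowDim`, p564701) certifies the chart primes OVER `𝔪_η` only; the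
spread (T2′) of a NON-primary centre consumes the FULL datum: EVERY prime `𝔔` of every chart `𝒪_η[(c′)/c′ⱼ]` FULL
(`FCUnguardedAprime.LocFixDataFull`). Proof: on the closed-point model `(X₀, b)` of `η` (`LocFixAtNonClosedLowDim.exists_model_of_dim`:
`𝒪_{X₀,b} ≅ 𝒪_{X₁,η}`, `X₀` an admissible CM variety with FINITELY many bad points) the #4β centre `J ∋ b` of Lipman / Cossart–Piltant
(`CentreData`: EVERY blow-up point over `supp J` FULL) gives generators `c` of `J_b`; a chart prime `𝔔` of `𝒪_b[(c)/c_j]` over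
`q = 𝔔 ∩ 𝒪_b` is the local ring of a point `x′` of `Bl_J X₀` over the generization `y₀ = Spec 𝒪_b (q)` of `b`
(`exists_point_of_blowupAlgebra_prime_any`, the general-prime twin of the tree's `IsBlowup.exists_point_of_blowupAlgebra_prime`,
Stacks 0804/0805, same proof); if `y₀ ∈ supp J` it is FULL by `CentreData`; if not, `𝒪_{x′} ≅ 𝒪_{X₀,y₀}`
(`IsBlowup.isIso_stalkMap_of_not_mem_support`) and `y₀ ≠ b` is a NON-CLOSED point of `X₀`, FULL because the bad locus of `X₀` is closed
(#2 `NonFullLocusClosed`) and finite, hence consists of closed points (`X₀` is Jacobson) (`fullCl_of_not_isClosed_of_finite`). Transport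
along `𝒪_{X₀,b} ≅ 𝒪_{X₁,η}` (`locFixFull_of_ringEquiv`). Main theorem `locFixFull_atNonClosed_lowDim (hL hG h081R hP hDM hCMo)` = the
binders of `FCUnguardedAprime.LocFixFullAtNonClosed` verbatim with `LocFixDataFull` unfolded. [folklore assembly]
-/

-- single-problem summit: the doubled namespace component is forced
set_option linter.dupNamespace false

noncomputable section

open AlgebraicGeometry CategoryTheory CategoryTheory.Limits Literature.AlgebraicGeometry.Resolution TopologicalSpace IsLocalRing

namespace Summit.ResolutionOfSingularities.ResolutionOfSingularities.Theorems.FInjectiveMacaulayfication.LocFixFullAtNonClosedLowDim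

open Summit.ResolutionOfSingularities.ResolutionOfSingularities.Theorems.FInjectiveMacaulayfication

/-! ## §1 The general-prime chart–point dictionary (Stacks 0804, twin of `IsBlowup.exists_point_of_blowupAlgebra_prime`) -/

set_option maxHeartbeats 800000 in
-- the comparison with `Proj` over `Spec 𝒪_{X,s}` elaborates large terms (as in the Literature original)
/-- **Every prime of `𝒪_{X,s}[J_s/c_j]` is the local ring of a point of the blowing up over the corresponding generization of `s`.**
`π : X' → X` a blowing up along `J`, `c` generators of `J_s`; for every chart index `j` and EVERY prime `𝔔` of `blowupAlgebra (c) c_j`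
(no condition over `𝔪_s`) there is `x' ∈ X'` with `π x' = Spec 𝒪_{X,s} → X` applied to `𝔔 ∩ 𝒪_{X,s}` and `𝒪_{X',x'} ≅ (𝒪_{X,s}[J_s/c_j])_𝔔`.
Same proof as the Literature closed-point version (base change to `Spec 𝒪_{X,s}`, `Proj` charts, pro-open stalk isomorphisms).
[folklore; cite: StacksProject, Tag 0804; StacksProject, Tag 0805] -/
theorem exists_point_of_blowupAlgebra_prime_any {X' X : Scheme.{0}} {π : X' ⟶ X} {J : X.IdealSheafData}
    (hπ : IsBlowup π J) (s : X) {k : ℕ}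
    (c : Fin k → X.presheaf.stalk s) (hc : Ideal.span (Set.range c) = stalkIdeal J s) (j : Fin k)
    (𝔔 : PrimeSpectrum (blowupAlgebra (Ideal.span (Set.range c)) (c j))) :
    ∃ x' : X', π x' = X.fromSpecStalk s ⟨𝔔.asIdeal.comap (algebraMap _ (blowupAlgebra (Ideal.span (Set.range c)) (c j))),
        Ideal.comap_isPrime _ _⟩ ∧
      Nonempty (X'.presheaf.stalk x' ≃+* Localization.AtPrime 𝔔.asIdeal) := by
  classical
  have hcj : ∀ j, c j ∈ Ideal.span (Set.range c) := fun j =>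
    Ideal.mem_span_range_self (f := c) (x := j)
  haveI : Flat (X.fromSpecStalk s) := flat_fromSpecStalk X s
  -- the base change `P = X' ×_X Spec 𝒪_{X,s} → Spec 𝒪_{X,s}` is a blowing up along `(J_s)~ = (c)~`
  have hP : IsBlowup (pullback.snd π (X.fromSpecStalk s))
      (affineBlowup.idealSheaf (Ideal.span (Set.range c))) := by
    have h := hπ.pullback_snd_of_flat (X.fromSpecStalk s)
    rwa [comap_fromSpecStalk_eq_affineBlowupIdealSheaf, ← hc] at h
  -- hence isomorphic to `Proj 𝒪_{X,s}[(c) t]` over `Spec 𝒪_{X,s}`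
  obtain ⟨e, he, -⟩ := (affineBlowup.isBlowup (Ideal.span (Set.range c))).unique hP
  -- the chart isomorphism `ε : B_j ≃ 𝒪_{X,s}[(c)/c_j]` and the point `w = ε⁻¹ 𝔔` of `Spec B_j`
  set ε : chartRing c j ≃+* blowupAlgebra (Ideal.span (Set.range c)) (c j) :=
    reesChartEquiv (I := Ideal.span (Set.range c)) (c j) (hcj j) with hεdef
  have hε : ∀ a, ε (chartBase c j a) = algebraMap _ (blowupAlgebra (Ideal.span (Set.range c)) (c j)) a :=
    reesChartEquiv_reesChartBase (c j) _
  let w : Spec (.of (chartRing c j)) :=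
    ⟨𝔔.asIdeal.comap (ε : chartRing c j →+* _), Ideal.comap_isPrime (ε : chartRing c j →+* _) 𝔔.asIdeal⟩
  have hmemw : ∀ b : chartRing c j, ε b ∈ 𝔔.asIdeal ↔ b ∈ w.asIdeal := fun b => Iff.rfl
  -- `w` lies over the point `𝔔 ∩ 𝒪_{X,s}` of `Spec 𝒪_{X,s}`
  have hw : (Spec.map (CommRingCat.ofHom (chartBase c j))).base w =
      ⟨𝔔.asIdeal.comap (algebraMap _ (blowupAlgebra (Ideal.span (Set.range c)) (c j))), Ideal.comap_isPrime _ _⟩ := by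
    rw [Spec.map_base]
    change PrimeSpectrum.comap (chartBase c j) w = _
    ext a
    change chartBase c j a ∈ w.asIdeal ↔ a ∈ 𝔔.asIdeal.comap (algebraMap _ (blowupAlgebra (Ideal.span (Set.range c)) (c j)))
    rw [← hmemw, hε, Ideal.mem_comap]
  -- the chart morphism `q : Spec B_j → Proj ≅ P → X'` and the point `x' = q w`
  let q : Spec (.of (chartRing c j)) ⟶ X' :=
    (affineBlowup.chartι (c j) (hcj j) ≫ e.hom) ≫ pullback.fst π (X.fromSpecStalk s)
  have hqπ : q ≫ π = Spec.map (CommRingCat.ofHom (chartBase c j)) ≫ X.fromSpecStalk s := by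
    rw [Category.assoc, pullback.condition, Category.assoc, reassoc_of% he, ← Category.assoc,
      affineBlowup.chartι_π (c j) (hcj j)]
  refine ⟨q w, ?_, ?_⟩
  · have h1 : π (q w) = (q ≫ π) w := (Scheme.Hom.comp_apply q π w).symm
    rw [h1, hqπ, Scheme.Hom.comp_apply, hw]
  · -- `𝒪_{X', q w} ≅ 𝒪_{Spec B_j, w} = (B_j)_w ≅ (𝒪_{X,s}[(c)/c_j])_𝔔`
    have h1 := isIso_stalkMap_pullback_fst_fromSpecStalk π s
      ((affineBlowup.chartι (c j) (hcj j) ≫ e.hom) w)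
    haveI : IsOpenImmersion (affineBlowup.chartι (c j) (hcj j) ≫ e.hom) := inferInstance
    have h2 : IsIso ((affineBlowup.chartι (c j) (hcj j) ≫ e.hom).stalkMap w) := inferInstance
    haveI : IsIso (q.stalkMap w) := by
      change IsIso (((affineBlowup.chartι (c j) (hcj j) ≫ e.hom) ≫ pullback.fst π (X.fromSpecStalk s)).stalkMap w)
      rw [Scheme.Hom.stalkMap_comp]
      exact @IsIso.comp_isIso _ _ _ _ _ _ _ h1 h2
    haveI := w.2
    haveI := 𝔔.2
    obtain ⟨e3⟩ := BlowupFiModelOfCover.nonempty_ringEquiv_localization_of_ringEquiv ε w.asIdeal 𝔔.asIdeal hmemw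
    exact ⟨((asIso (q.stalkMap w)).commRingCatIsoToRingEquiv.trans
      (Spec.stalkIso (.of (chartRing c j)) w).commRingCatIsoToRingEquiv).trans e3⟩

/-! ## §2 `FullCl` transport and the model's non-closed points -/

/-- On a CM integral scheme locally of finite type over a field with FINITELY many non-F-good points, every NON-CLOSED point is
FULL: the bad locus is closed (#2, `NonFullLocusClosed`), so it contains the closure of each of its points; a non-closed point has an
infinite closure in a Jacobson space (its closed points are dense in it), contradicting finiteness. [folklore; cite: DattaMurayama2024, Thm. B]
-/
theorem fullCl_of_not_isClosed_of_finite
    (hDM : Literature.AlgebraicGeometry.Resolution.DattaMurayama2024_fInjectiveLocusOpen.{0})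
    (hCMo : NonFullLocusClosed.CMLocusOpen) {p : ℕ} (hp : p.Prime) {K : Type} [Field K] [CharP K p]
    {X : Scheme.{0}} (f : X ⟶ Spec (.of K)) [LocallyOfFiniteType f] [QuasiCompact f] [IsIntegral X]
    (hCM : ∀ x : X, SliceableCentre.CMCl (X.presheaf.stalk x))
    (hfin : Set.Finite {x : X | ¬ SliceableCentre.FCl p (X.presheaf.stalk x)})
    {y : X} (hy : ¬ IsClosed ({y} : Set X)) : SliceableCentre.FullCl p (X.presheaf.stalk y) := by
  -- the bad locus `B` is closed and finite
  have hclosed := NonFullLocusClosed.nonFullLocusClosed_of_named hDM hCMo p hp K X f inferInstance inferInstance inferInstance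
  have hB : {x : X | ¬ NonFullLocusClosed.Clause p (X.presheaf.stalk x)} = {x : X | ¬ SliceableCentre.FCl p (X.presheaf.stalk x)} := by
    ext x
    simp only [Set.mem_setOf_eq, NonFullLocusClosed.clause_iff, not_and]
    exact ⟨fun h => h (hCM x), fun h _ => h⟩
  rw [hB] at hclosed
  -- if `y` were bad, its closure would be a finite closed set of a Jacobson space, hence consist of closed points
  have hgood : SliceableCentre.FCl p (X.presheaf.stalk y) := by
    by_contra hybad
    haveI : JacobsonSpace X := LocallyOfFiniteType.jacobsonSpace f
    have hsub : closure ({y} : Set X) ⊆ {x : X | ¬ SliceableCentre.FCl p (X.presheaf.stalk x)} :=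
      hclosed.closure_subset_iff.mpr (Set.singleton_subset_iff.mpr hybad)
    have hfin' : (closure ({y} : Set X) ∩ closedPoints X).Finite := (hfin.subset hsub).subset Set.inter_subset_left
    have hcl' : IsClosed (closure ({y} : Set X) ∩ closedPoints X) := by
      rw [← Set.biUnion_of_singleton (closure ({y} : Set X) ∩ closedPoints X)]
      exact hfin'.isClosed_biUnion fun x hx => hx.2
    have hdense := JacobsonSpace.closure_inter_closedPoints (X := X) (isClosed_closure (s := ({y} : Set X)))
    rw [hcl'.closure_eq] at hdense
    have hyin : y ∈ closure ({y} : Set X) ∩ closedPoints X := by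
      rw [hdense]
      exact subset_closure (Set.mem_singleton y)
    exact hy hyin.2
  haveI : IsDomain (X.presheaf.stalk y) := inferInstance
  exact ⟨inferInstance, fun d hd s hs => ⟨hCM y d hd s hs, hgood d hd s hs⟩⟩

/-- **The FULL (A′)-datum transports along ring isomorphisms of local rings** (the all-primes twin of
`WFixAtNonClosedDimTwo.locFixAprime_of_ringEquiv`). [folklore] -/
theorem locFixFull_of_ringEquiv (p : ℕ) {O O' : Type} [CommRing O] [CommRing O'] [IsLocalRing O] [IsLocalRing O']
    (e : O ≃+* O')
    (h : ∃ (n : ℕ) (c : Fin n → O), Ideal.span (Set.range c) ≠ ⊥ ∧ Ideal.span (Set.range c) ≤ maximalIdeal O ∧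
        ∀ (j : Fin n) (𝔔 : PrimeSpectrum (blowupAlgebra (Ideal.span (Set.range c)) (c j))),
          SliceableCentre.FullCl p (Localization.AtPrime 𝔔.asIdeal)) :
    ∃ (n : ℕ) (c : Fin n → O'), Ideal.span (Set.range c) ≠ ⊥ ∧ Ideal.span (Set.range c) ≤ maximalIdeal O' ∧
        ∀ (j : Fin n) (𝔔 : PrimeSpectrum (blowupAlgebra (Ideal.span (Set.range c)) (c j))),
          SliceableCentre.FullCl p (Localization.AtPrime 𝔔.asIdeal) := by
  obtain ⟨n, c, hne, hle, hcl⟩ := h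
  have hI : Ideal.span (Set.range fun j : Fin n => e (c j)) = Ideal.map e (Ideal.span (Set.range c)) :=
    PointFixableTransport.span_range_comp e c
  refine ⟨n, fun j => e (c j), ?_, ?_, ?_⟩
  · rw [hI]
    exact fun h0 => hne ((Ideal.map_eq_bot_iff_of_injective e.injective).mp h0)
  · rw [hI, Ideal.map_le_iff_le_comap]
    intro x hx
    rw [Ideal.mem_comap]
    exact (PointFixableTransport.mem_maximalIdeal_iff e x).mpr (hle hx)
  · intro j 𝔔'
    obtain ⟨E, hE⟩ := PointFixableTransport.exists_blowupAlgebra_congr' e (Ideal.span (Set.range c)) (c j) _ _ hI rfl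
    let 𝔔 : PrimeSpectrum (blowupAlgebra (Ideal.span (Set.range c)) (c j)) :=
      ⟨𝔔'.asIdeal.comap E.toRingHom, Ideal.comap_isPrime _ _⟩
    have hF := hcl j 𝔔
    haveI := 𝔔.isPrime
    haveI := 𝔔'.isPrime
    obtain ⟨eL⟩ := BlowupFiModelOfCover.nonempty_ringEquiv_localization_of_ringEquiv E 𝔔.asIdeal 𝔔'.asIdeal
      (fun x => Iff.rfl)
    exact WFixAtNonClosedDimTwo.fullCl_of_ringEquiv p eL hF

/-! ## §3 The adapter: `CentreData` at `b` + FULL proper generizations of `b` ⇒ the FULL (A′)-datum in `𝒪_b` -/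

/-- **ADAPTER `CentreData ⇒ (A′-full)`**: if a nonzero global centre `J ∋ b` has every blow-up FULL over `supp J`, and every PROPER
generization of `b` is a FULL point of `X`, then the generators `c` of `J_b` form a FULL (A′)-datum: EVERY prime `𝔔` of every chart
`𝒪_b[(c)/c_j]` is FULL — it is the local ring of a blow-up point `x′` over the generization `y₀` of `b` cut out by `𝔔 ∩ 𝒪_b`
(`exists_point_of_blowupAlgebra_prime_any`); over `supp J` use `CentreData`, off `supp J` the blow-up is a local isomorphism
(`IsBlowup.isIso_stalkMap_of_not_mem_support`) and `y₀ ≠ b`. [folklore; cite: StacksProject, Tag 0804] -/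
theorem locFixFull_of_centreData (p : ℕ) {X : Scheme.{0}} [IsIntegral X] [IsLocallyNoetherian X] (b : X)
    (h : SliceableCentre.CentreData p X b)
    (hgood : ∀ y : X, y ⤳ b → y ≠ b → SliceableCentre.FullCl p (X.presheaf.stalk y)) :
    ∃ (n : ℕ) (c : Fin n → X.presheaf.stalk b), Ideal.span (Set.range c) ≠ ⊥ ∧
      Ideal.span (Set.range c) ≤ maximalIdeal (X.presheaf.stalk b) ∧
      ∀ (j : Fin n) (𝔔 : PrimeSpectrum (blowupAlgebra (Ideal.span (Set.range c)) (c j))),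
        SliceableCentre.FullCl p (Localization.AtPrime 𝔔.asIdeal) := by
  obtain ⟨J, hJ, hb, hfull⟩ := h
  have hfg : (stalkIdeal J b).FG := IsNoetherian.noetherian _
  obtain ⟨n, c, hc⟩ := Submodule.fg_iff_exists_fin_generating_family.mp hfg
  have hc' : Ideal.span (Set.range c) = stalkIdeal J b := hc
  obtain ⟨X', π, hπ⟩ := exists_isBlowup X J
  refine ⟨n, c, ?_, ?_, ?_⟩
  · rw [hc']
    exact stalkIdeal_ne_bot_of_ne_bot hJ b
  · rw [hc']
    exact (mem_support_iff_stalkIdeal_le J b).mp hb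
  · intro j 𝔔
    obtain ⟨x', hx', ⟨e⟩⟩ := exists_point_of_blowupAlgebra_prime_any hπ b c hc' j 𝔔
    by_cases hmem : π.base x' ∈ (J.support : Set X)
    · exact WFixAtNonClosedDimTwo.fullCl_of_ringEquiv p e (hfull X' π hπ x' hmem)
    · -- off `supp J`: `𝒪_{X',x'} ≅ 𝒪_{X, π x'}`, and `π x'` is a proper generization of `b`
      haveI := hπ.isIso_stalkMap_of_not_mem_support (x' := x') hmem
      have eπ : X.presheaf.stalk (π.base x') ≃+* X'.presheaf.stalk x' := (asIso (π.stalkMap x')).commRingCatIsoToRingEquiv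
      have hsp : π.base x' ⤳ b := by
        have hr : π.base x' ∈ Set.range (X.fromSpecStalk b).base := ⟨_, hx'.symm⟩
        rw [Scheme.range_fromSpecStalk] at hr
        exact hr
      have hne : π.base x' ≠ b := fun h => hmem (h ▸ hb)
      exact WFixAtNonClosedDimTwo.fullCl_of_ringEquiv p (eπ.trans e) (hgood _ hsp hne)

/-! ## §4 The rungs and the main theorem -/

/-- On the closed-point model, proper generizations of any point `b` are FULL (a proper generization is never a closed point). [plumbing] -/
theorem hgood_model
    (hDM : Literature.AlgebraicGeometry.Resolution.DattaMurayama2024_fInjectiveLocusOpen.{0})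
    (hCMo : NonFullLocusClosed.CMLocusOpen) {p : ℕ} (hp : p.Prime) {K : Type} [Field K] [CharP K p]
    {X : Scheme.{0}} (f : X ⟶ Spec (.of K)) [LocallyOfFiniteType f] [QuasiCompact f] [IsIntegral X]
    (hCM : ∀ x : X, SliceableCentre.CMCl (X.presheaf.stalk x))
    (hfin : Set.Finite {x : X | ¬ SliceableCentre.FCl p (X.presheaf.stalk x)}) (b : X) :
    ∀ y : X, y ⤳ b → y ≠ b → SliceableCentre.FullCl p (X.presheaf.stalk y) := by
  intro y hyb hne
  refine fullCl_of_not_isClosed_of_finite hDM hCMo hp f hCM hfin fun hycl => hne ?_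
  -- a closed point specializing to `b` equals `b`
  have h := hyb.mem_closed hycl (Set.mem_singleton y)
  exact (Set.mem_singleton_iff.mp h).symm

/-- **(T1″) ⟸ Lipman 1978 + Cossart–Piltant 2019** (+ #2 and `CMLocusOpen`): the binders of `FCUnguardedAprime.LocFixFullAtNonClosed`
VERBATIM, conclusion `LocFixDataFull` unfolded — at every non-closed bad `η` with `2 ≤ dim 𝒪_η ≤ 3` and good proper generizations there is
`(c′) ⊂ 𝒪_η`, `(c′) ≠ ⊥`, `(c′) ≤ 𝔪_η`, with EVERY prime of EVERY chart `𝒪_η[(c′)/c′ⱼ]` FULL. Dim 2: Lipman on an affine open of the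
model; dim 3: Cossart–Piltant on the model; both through `locFixFull_of_centreData` + `hgood_model` + `locFixFull_of_ringEquiv`.
[folklore assembly; cite: Lipman1978; CossartPiltant2019, Thm. 1.1; DattaMurayama2024, Thm. B; StacksProject, Tag 0804] -/
theorem locFixFull_atNonClosed_lowDim
    (hL : Literature.AlgebraicGeometry.Resolution.Lipman1978SequenceFinite.{0})
    (hG : Literature.AlgebraicGeometry.Resolution.CossartPiltant2019General.{0})
    (h081R : Literature.AlgebraicGeometry.Resolution.Stacks081R.{0})
    (hP : Literature.AlgebraicGeometry.Resolution.CossartPiltant2019Principalization.{0})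
    (hDM : Literature.AlgebraicGeometry.Resolution.DattaMurayama2024_fInjectiveLocusOpen.{0})
    (hCMo : NonFullLocusClosed.CMLocusOpen) :
    ∀ (p : ℕ), p.Prime → ∀ (k : Type) [Field k] [CharP k p]
    (X₁ : Scheme.{0}) (f₁ : X₁ ⟶ Spec (.of k)),
      IsSeparated f₁ → LocallyOfFiniteType f₁ → QuasiCompact f₁ → IsIntegral X₁ → 4 ≤ topologicalKrullDim X₁ →
      (∀ x : X₁, SliceableCentre.CMCl (X₁.presheaf.stalk x)) →
      ∀ η : X₁, ¬ IsClosed ({η} : Set X₁) → ¬ SliceableCentre.FCl p (X₁.presheaf.stalk η) →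
        2 ≤ ringKrullDim (X₁.presheaf.stalk η) → ringKrullDim (X₁.presheaf.stalk η) ≤ 3 →
        (∀ y : X₁, y ⤳ η → y ≠ η → SliceableCentre.FCl p (X₁.presheaf.stalk y)) →
        ∃ (n' : ℕ) (c' : Fin n' → X₁.presheaf.stalk η),
      Ideal.span (Set.range c') ≠ ⊥ ∧ Ideal.span (Set.range c') ≤ maximalIdeal (X₁.presheaf.stalk η) ∧
        ∀ (j : Fin n') (𝔔 : PrimeSpectrum (blowupAlgebra (Ideal.span (Set.range c')) (c' j))),
          SliceableCentre.FullCl p (Localization.AtPrime 𝔔.asIdeal) := by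
  intro p hp k _ _ X₁ f₁ _ hft hqc hint _ hCM η _ hbad h2 h3 hgen
  haveI := hft
  haveI := hqc
  haveI := hint
  rcases PointFixWildOfPFW.eq_two_or_eq_three h2 h3 with hdim | hdim
  · /- dim 2: Lipman on an affine open of the model -/
    obtain ⟨K₀, instF, instC, X₀, f₀, hsep₀, hft₀, hqc₀, hint₀, hdim₀, hCM₀, hfin₀, b, hbcl, hbbad, ⟨e⟩⟩ :=
      LocFixAtNonClosedLowDim.exists_model_of_dim hDM hCMo hp f₁ hCM hbad hdim hgen
    haveI := hsep₀
    haveI := hft₀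
    haveI := hqc₀
    haveI := hint₀
    have hgoodX₀ := hgood_model hDM hCMo hp f₀ hCM₀ hfin₀ b
    obtain ⟨U, hU, hbU, -⟩ := exists_isAffineOpen_mem_and_subset (X := X₀) (x := b) (U := ⊤) (Opens.mem_top b)
    haveI : IsAffine (U : Scheme.{0}) := hU
    obtain ⟨hintU, hCMU, hfinU⟩ := WFixAtNonClosedDimTwo.admissible_restrict p hCM₀ hfin₀ U hbU
    haveI := hintU
    have hdimU : topologicalKrullDim (U : Scheme.{0}) ≤ (2 : ℕ) := by
      have h := U.ι.isOpenEmbedding.isInducing.topologicalKrullDim_le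
      rw [hdim₀] at h
      exact h
    let b' : (U : Scheme.{0}) := ⟨b, hbU⟩
    have eU : (U : Scheme.{0}).presheaf.stalk b' ≃+* X₀.presheaf.stalk b := (U.stalkIso b').commRingCatIsoToRingEquiv
    have hbcl' : IsClosed ({b'} : Set (U : Scheme.{0})) := WFixAtNonClosedDimTwo.isClosed_singleton_restrict U hbU hbcl
    have hbbad' : ¬ SliceableCentre.FCl p ((U : Scheme.{0}).presheaf.stalk b') :=
      fun h => hbbad (FiLocusOpenOfAffine.fClause_of_ringEquiv p eU h)
    have hC : SliceableCentre.CentreData p (U : Scheme.{0}) b' :=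
      TameWildSplit.closedCentreExistsAffineDimLe2_of_lipman hL p hp K₀ (U : Scheme.{0}) (U.ι ≫ f₀) inferInstance inferInstance
        inferInstance hintU hdimU hU hCMU hfinU b' hbcl' hbbad'
    haveI : IsLocallyNoetherian (U : Scheme.{0}) := LocallyOfFiniteType.isLocallyNoetherian (U.ι ≫ f₀)
    -- proper generizations of `b'` in `U` are FULL (they are proper generizations of `b` in `X₀`)
    have hgoodU : ∀ y : (U : Scheme.{0}), y ⤳ b' → y ≠ b' → SliceableCentre.FullCl p ((U : Scheme.{0}).presheaf.stalk y) := by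
      intro y hyb hne
      have hyb₀ : y.1 ⤳ b := hyb.map continuous_subtype_val
      have hne₀ : y.1 ≠ b := fun h => hne (Subtype.ext h)
      exact WFixAtNonClosedDimTwo.fullCl_of_ringEquiv p (U.stalkIso y).commRingCatIsoToRingEquiv.symm (hgoodX₀ y.1 hyb₀ hne₀)
    have hA := locFixFull_of_centreData p (X := (U : Scheme.{0})) b' hC hgoodU
    exact locFixFull_of_ringEquiv p (eU.trans e) hA
  · /- dim 3: Cossart–Piltant on the model -/
    obtain ⟨K₀, instF, instC, X₀, f₀, hsep₀, hft₀, hqc₀, hint₀, hdim₀, hCM₀, hfin₀, b, hbcl, hbbad, ⟨e⟩⟩ :=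
      LocFixAtNonClosedLowDim.exists_model_of_dim hDM hCMo hp f₁ hCM hbad hdim hgen
    haveI := hft₀
    haveI := hqc₀
    haveI := hint₀
    have hdim₀' : topologicalKrullDim X₀ = 3 := by rw [hdim₀]; rfl
    have hC : SliceableCentre.CentreData p X₀ b :=
      ClosedCentreDimEq3.closedCentreExistsDimEq3_of_cp hG h081R hP p hp K₀ X₀ f₀ hsep₀ hft₀ hqc₀ hint₀ hdim₀' hCM₀ hfin₀ b hbcl hbbad
    haveI : IsLocallyNoetherian X₀ := LocallyOfFiniteType.isLocallyNoetherian f₀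
    have hA := locFixFull_of_centreData p b hC (hgood_model hDM hCMo hp f₀ hCM₀ hfin₀ b)
    exact locFixFull_of_ringEquiv p e hA

end Summit.ResolutionOfSingularities.ResolutionOfSingularities.Theorems.FInjectiveMacaulayfication.LocFixFullAtNonClosedLowDim

end
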